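import Literature.NumberTheory.EllipticCurves.CastellaGrossiSkinner2025.AnticyclotomicMainConjectures
import Literature.NumberTheory.EllipticCurves.YanZhu2026.GreenbergMainTheoremsAnyRoot
import Literature.NumberTheory.EllipticCurves.BurungaleCastellaSkinner2025.GreenbergMuInvariantProofs
import HarnessLib

/-!
# Castella–Grossi–Skinner 2025, Thm. 6.5.3, LAST SENTENCE — "Hence the anticyclotomic Iwasawa–Greenberg
# main conjecture in Conjecture 3.2.2 holds": `ch_{Λ_K⁻}(𝔛_Gr(E/K_∞⁻)) Λ_K^{−,ur} = (𝓛_p^Gr(f/K)⁻)` at a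
# good non-anomalous Eisenstein prime — PROVED from the named facts Thm. 6.5.3 (BDP display) and
# Prop. 2.4.5 (= Yan–Zhu 2026 Prop. 3.14); theorems only

HONEST FRAMING (cell `bsd-littype` = BSD share of the cross-ladder LITERATURE-TYPING layer, D-0088(4);
seat `bsd-littype-02`, gen 6; run/shared/lean/pub/bsd-littype/): typed ≠ proved ≠ endorsed; no tranche
here proves BSD. This file introduces NO definition and NO named fact (0 new debt): every declaration is a
`theorem` over tree theorems and the EXISTING named facts taken as explicit hypotheses —
`thm653_exists_isBDPLFunction_isTorsion_charIdeal_map_eq` (printed Thm. 6.5.3, its BDP display,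
`AnticyclotomicMainConjectures.lean`, gen 0) and `YanZhu2026.prop314_span_minus_eq_span_bdp_anyRoot`
(Yan–Zhu 2026 Prop. 3.14, printed proof "See [CGS, Proposition 2.4.5]", `GreenbergMainTheoremsAnyRoot.lean`,
seat `bsd-littype-04` gen 4, orientation settled OPEN-QUESTIONS-02 Q14 / -04 Q21′). Companion of
`PerrinRiouMainConjectureLiteralFormProofs.lean` (the same service for the FIRST line of Conj. 3.2.2 =
Thm. 7.2.3 on the cyclotomic line).

WHY. Theorem 6.5.3 PRINTS two clauses (final TeX l.3246–3256): the BDP display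
"`char_Λ(𝔛_Gr(E/K_∞⁻))Λ^ur = (𝓛_p^BDP(f/K))` as ideals in `Λ^ur`" — typed at gen 0 as `thm653_…` in the
CGLS22 currency (`IsBDPLFunction`, `AcSelmer.XAc`, `R₀ = unrIntegers p`) — and the sentence "Hence the
anticyclotomic Iwasawa–Greenberg main conjecture in Conjecture 3.2.2 holds", i.e. the SECOND line of
Conj. 3.2.2 (l.1187–1194), `ch_{Λ_K⁻}(𝔛_Gr(E/K_∞⁻)) Λ_K^{−,ur} = (𝓛_p^Gr(f/K)⁻)`, which follows from the
BDP display by Prop. 2.4.5 (l.1019–1028: "`𝓛_p^Gr(f/K)⁻ · Λ_K^{−,ur} = 𝓛_p^BDP(f/K) · Λ_K^{−,ur}`"). The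
"Hence" clause was NOT typed at gen 0 (no carrier for Greenberg's two-variable `𝓛_p^Gr(f/K)` then;
SHEETS-02 gen-0 GAP row). The carrier has since landed in the refereed Yan–Zhu 2026 currency
(`IsGreenbergLFunctionAnyRoot₂ ι 𝔭 𝔭̄ κ₁ κ₂ γ₁⁻¹ γ₂⁻¹ f |d_K| h_K LK G`: Yan–Zhu Def. 3.11 "`𝓛_p^Gr(f/K) :=
h_K · 𝓛_𝔭(K)' · 𝓛_p^{II}(f/K)`", arXiv:2412.20078v4 TeX l.865–871, which is [CGS] Def. 2.4.3 "`𝓛_p^Gr(f/K)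
:= h_K · 𝓛_v(K)⁻ · 𝓛_p(f/K, Σ^{(2')})`", l.983–990, re-vendored consistently — seat `bsd-littype-04`
(T1)–(T7); `𝓛 ↦ 𝓛⁻` = `UnrSeries₂.minus`, "`γ⁺ ↦ 1`"), together with Prop. 2.4.5 in that currency
(`prop314_…_anyRoot`: `(minus G) = (map J₀ 𝓛_p^BDP)` in `𝒪_{ℂ_p}⟦T⟧` for every BDP frame and every
structure-compatible `J₀ : R₀ → 𝒪_{ℂ_p}`). So the "Hence" clause is now statable in tree vocabulary and
this file PROVES it from the two named facts: `𝔛_Gr(E/K_∞⁻)` is `Λ`-torsion and, along every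
structure-compatible `J : ℤ_p → 𝒪_{ℂ_p}`, `(char_Λ 𝔛_Gr) · 𝒪_{ℂ_p}⟦T⟧ = (𝓛_p^Gr(f/K)⁻)` — the BDP frame of
Thm. 6.5.3 is fed to Prop. 2.4.5, the structure maps `ℤ_p → R₀ → 𝒪_{ℂ_p}` are composed
(`exists_ringHom_padicInt_unrIntegers`, `exists_ringHom_unrIntegers_padicComplexInt`), and a
structure-compatible `J` is unique (`𝒪_{ℂ_p} ↪ ℂ_p`). Coefficients: the printed `Λ_K^{−,ur} = Λ⁻ ⊗̂
ℤ_p^ur` is read, as in every Yan–Zhu Greenberg-side statement of the tree, inside `𝒪_{ℂ_p}⟦T⟧` (faithfully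
flat over `ℤ_p^ur⟦T⟧`; reading (T1) of `GreenbergMainTheoremsAnyRoot.lean`).

## Citation header (final TeX of the accepted version = arXiv:2303.04373v2 = Math. Ann. 393 (2025),
`run/shared/lean/b2b/bsd-rank1-residual/b2b-bsdres-lit-cgls/src/cgs25-final/Mazur-paper_revised.tex`)

* **Theorem 6.5.3** (`thm:BDP-IMC`, l.3246–3256; v1 Thm. 5.5.3), verbatim: "Suppose `K` satisfies
  hypotheses (Heeg), (spl), and (disc), and that `E[p]^{ss} = 𝔽_p(φ) ⊕ 𝔽_p(ψ)` as `G_ℚ`-modules, with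
  `φ|_{G_p} ≠ 𝟙, ω`. Then `𝔛_Gr(E/K_∞⁻)` is `Λ`-torsion, and `char_Λ(𝔛_Gr(E/K_∞⁻))Λ^ur = (𝓛_p^BDP(f/K))`
  as ideals in `Λ^ur`. Hence the anticyclotomic Iwasawa–Greenberg main conjecture in Conjecture 3.2.2
  holds." (§6 standing hypotheses l.2258–2262, incl. (h1) `E(K)[p] = 0`.)
* **Conjecture 3.2.2** (`conj:IMC-K`, l.1187–1194), second line: "`ch_{Λ_K⁻}(𝔛_Gr(E/K_∞⁻)) Λ_K^{−,ur}
  = (𝓛_p^Gr(f/K)⁻)`."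
* **Definition 2.4.3** (`def:Gr`, l.983–990): "`𝓛_p^Gr(f/K) := h_K · 𝓛_v(K)⁻ · 𝓛_p(f/K, Σ^{(2')})`";
  l.1019: "Denote by `𝓛_p^Gr(f/K)⁻` the image of `𝓛_p^Gr(f/K)` under the natural projection `Λ_K^ur →
  Λ_K^{−,ur}`."
* **Proposition 2.4.5** (`prop:comp-Lac`, l.1021–1028): "We have the equality `𝓛_p^Gr(f/K)⁻ · Λ_K^{−,ur}
  = 𝓛_p^BDP(f/K) · Λ_K^{−,ur}`." — tree: `YanZhu2026.prop314_span_minus_eq_span_bdp_anyRoot` (Yan–Zhu,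
  J. Algebra 693 (2026), Prop. 3.14, arXiv:2412.20078v4 TeX l.896–903, proof "See [CGS, Proposition
  2.4.5]"; Def. 3.11 l.865–871 = [CGS] Def. 2.4.3).

## Transcription of the "Hence" clause (tree vocabulary only; binder for binder)

* Setting: `YanZhu2026.GreenbergSetting ι W N K 𝔭 𝔭̄ κ₁ κ₂` — `(N : ℤ) = N_E`, `3 ≤ p`, `GoodOrd W p`, `K`
  imaginary quadratic, (spl), `𝔭 ∋ p` the prime induced by the embedding datum `ι` (the field `compat`
  is VERBATIM the `v`-hypothesis of `thm653_…`), `𝔭̄ ∋ p`, `𝔭̄ ≠ 𝔭`, `(N, d_K) = 1`, (disc) `d_K` odd and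
  `≠ −3`, `(κ₁, κ₂)` THE cyclotomic/anticyclotomic pair — plus `SatisfiesHeegnerHypothesis N K` (Heeg),
  the Eisenstein hypotheses `Red W p`, `¬ Anom W p` (with `Good W p = hset.goodOrd.1`, `2 < p`), and §6's
  (h1) `E(K)[p] = 0` (`∀ Q : (W.baseChange K).toAffine.Point, p • Q = 0 → Q = 0`); an adapted generator
  pair `(γ₁, γ₂)` (`Fact (ZpExtension.IsTopGeneratorPair κ₁ κ₂ γ₁ γ₂)`), `f` the newform of `W` at level
  `N`.
* `𝔛_Gr(E/K_∞⁻)` ↦ `AcSelmer.XAc (W.baseChange K) p κ₂ 𝔭̄ ∅ γ₂` (relaxed at `𝔭`, strict at `𝔭̄`; VERBATIM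
  the object of `thm653_…`); `ch_{Λ_K⁻}` ↦ `AcSelmer.XAc.charIdeal`.
* `𝓛_p^Gr(f/K)⁻` ↦ `UnrSeries₂.minus G` for EVERY Katz/Greenberg frame `(LK, G)` read at `(γ₁⁻¹, γ₂⁻¹)`
  (`IsKatzMeasure₂ ι 𝔭 𝔭̄ ∅ κ₁ κ₂ γ₁⁻¹ γ₂⁻¹ 1 Ω δ Ω_p LK`, `IsGreenbergLFunctionAnyRoot₂ ι 𝔭 𝔭̄ κ₁ κ₂ γ₁⁻¹ γ₂⁻¹
  f |d_K| h_K LK G`) — VERBATIM the binders of `prop314_…_anyRoot`.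
* "`· Λ_K^{−,ur} = (·)`" ↦ `(AcSelmer.XAc.charIdeal …).map (PowerSeries.map J) = Ideal.span {minus G}` in
  `𝒪_{ℂ_p}⟦T⟧`, for EVERY ring map `J : ℤ_[p] →+* PadicComplexInt p` with `J x = x` in `ℂ_p` (one
  exists: `YanZhu2026`-side `exists_structureMap_padicInt`).

FAITHFULNESS: FAITHFUL to the printed "Hence" clause = Conj. 3.2.2 second line (torsion + equality),
with `𝓛_p^Gr(f/K)` carried by the Yan–Zhu re-vendoring of [CGS] Def. 2.4.3 (the carrier identification
of record, seat `bsd-littype-04` (T1)–(T7); the product-frame twin `CastellaGrossiSkinner2025.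
IsGreenbergLFunction` is not bridged to it — OPEN-QUESTIONS-02 R2) and `Λ_K^{−,ur}` read in
`𝒪_{ℂ_p}⟦T⟧`; hypotheses = those of Thm. 6.5.3 (incl. (h1)) ∪ the frame data of Prop. 2.4.5; never
stronger than print. Nothing is asserted: every theorem is conditional on the two named facts.

## References
* [CastellaGrossiSkinner2025] Math. Ann. **393** (2025) 2451–2506 = arXiv:2303.04373v2: Thm. 6.5.3
  (l.3246–3256), Conj. 3.2.2 (l.1187–1194), Def. 2.4.3 (l.983–990), l.1019, Prop. 2.4.5 (l.1021–1028).
* [YanZhu2024MainConjNonCM] J. Algebra **693** (2026) = arXiv:2412.20078v4: Def. 3.11 (l.865–871),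
  Prop. 3.14 (l.896–903), §3.5 (l.894, `Λ_K^ur → Λ_K^{ur,±}`).
* [Castella2018] F. Castella, Math. Ann. (2018) = arXiv:1704.06608, §3 (`R₀ ⊂ ℂ_p`).
* pub/bsd-littype/staging/bsd-littype-02/SHEETS-02.md (gen-6 addendum, FILE 14).
-/

noncomputable section

open scoped Classical
open PowerSeries WeierstrassCurve NumberField IsDedekindDomain Field
  Literature.NumberTheory.GaloisRepresentations Literature.NumberTheory.EllipticCurves
  Literature.NumberTheory.EllipticCurves.ModularForms Literature.NumberTheory.EllipticCurves.Rank1Residual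

/-! ### 1. The structure map `ℤ_p → R₀` and uniqueness of structure-compatible maps -/

namespace Literature.NumberTheory.EllipticCurves

variable (p : ℕ) [Fact p.Prime]

/-- `ℤ_p ⊆ R₀` inside `ℂ_p`: `ℤ` is dense in `ℤ_p`, `ℤ ⊆ R₀`, and `R₀` is closed (the same term as the
Summits-side `X11b.Halves.algebraMap_coe_padicInt_mem_unrIntegers`, which a Literature file cannot
import). [cite: Castella2018, §3 (R₀ = the completion of 𝓞(ℚ_p^ur) ⊂ ℂ_p, arXiv:1704.06608 p. 9)] -/
theorem algebraMap_coe_padicInt_mem_unrIntegers (x : ℤ_[p]) :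
    algebraMap ℚ_[p] ℂ_[p] (x : ℚ_[p]) ∈ unrIntegers p := by
  have hc : Continuous fun y : ℤ_[p] ↦ algebraMap ℚ_[p] ℂ_[p] (y : ℚ_[p]) :=
    (continuous_algebraMap ℚ_[p] ℂ_[p]).comp continuous_subtype_val
  have hx : x ∈ closure (Set.range (Int.cast : ℤ → ℤ_[p])) := by
    rw [PadicInt.denseRange_intCast.closure_range]
    exact Set.mem_univ x
  have h := map_mem_closure (t := (unrIntegers p : Set ℂ_[p])) hc hx (by
    rintro _ ⟨n, rfl⟩
    show algebraMap ℚ_[p] ℂ_[p] (((n : ℤ_[p]) : ℚ_[p])) ∈ unrIntegers p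
    rw [PadicInt.coe_intCast, map_intCast]
    exact intCast_mem_unrIntegers n)
  rwa [(isClosed_unrIntegers (p := p)).closure_eq] at h

/-- **A ring map `j : ℤ_p → R₀` compatible with `ℤ_p ⊂ ℚ_p ⊂ ℂ_p` EXISTS** — the structure map along
which `thm653_…` reads "`char_Λ(𝔛_Gr)·Λ^ur`" (`Ideal.map (PowerSeries.map j)`); so its clause "for every
structure-compatible `j`" is never vacuous. [cite: Castella2018, §3 (Λ^ur = Λ ⊗̂ R₀, arXiv:1704.06608 p. 9)] -/
theorem exists_ringHom_padicInt_unrIntegers :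
    ∃ j : ℤ_[p] →+* unrIntegers p,
      ∀ x : ℤ_[p], ((j x : unrIntegers p) : ℂ_[p]) = algebraMap ℚ_[p] ℂ_[p] (x : ℚ_[p]) :=
  ⟨((algebraMap ℚ_[p] ℂ_[p]).comp PadicInt.Coe.ringHom).codRestrict (unrIntegers p)
      (algebraMap_coe_padicInt_mem_unrIntegers p), fun _ ↦ rfl⟩

variable {p}

/-- **Structure-compatible maps `ℤ_p → 𝒪_{ℂ_p}` are unique**: a ring map `J` with `J x = x` in `ℂ_p`
is the composite `J₀ ∘ j` of any compatible `j : ℤ_p → R₀` and `J₀ : R₀ → 𝒪_{ℂ_p}` (`𝒪_{ℂ_p} ↪ ℂ_p` is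
injective). [cite: YanZhu2024MainConjNonCM, §3.4 (Λ_K^ur := Λ_K ⊗̂ ℤ_p^ur, arXiv:2412.20078v4 TeX l.851) — the structure map is canonical] -/
theorem ringHom_padicComplexInt_eq_comp {J : ℤ_[p] →+* PadicComplexInt p}
    (hJ : ∀ x : ℤ_[p], ((J x : PadicComplexInt p) : ℂ_[p]) = ((x : ℚ_[p]) : ℂ_[p]))
    {j : ℤ_[p] →+* unrIntegers p}
    (hj : ∀ x : ℤ_[p], ((j x : unrIntegers p) : ℂ_[p]) = algebraMap ℚ_[p] ℂ_[p] (x : ℚ_[p]))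
    {J₀ : unrIntegers p →+* PadicComplexInt p}
    (hJ₀ : ∀ x : unrIntegers p, ((J₀ x : PadicComplexInt p) : ℂ_[p]) = (x : ℂ_[p])) :
    J = J₀.comp j := by
  refine RingHom.ext fun x ↦ Subtype.ext ?_
  rw [RingHom.comp_apply, hJ, hJ₀, hj]
  rfl

end Literature.NumberTheory.EllipticCurves

/-! ### 2. Theorem 6.5.3, "Hence" clause: `ch_{Λ_K⁻}(𝔛_Gr(E/K_∞⁻)) Λ_K^{−,ur} = (𝓛_p^Gr(f/K)⁻)` -/

namespace Literature.NumberTheory.EllipticCurves.CastellaGrossiSkinner2025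

open UnrSeries₂ YanZhu2026 Castella2018

variable {p : ℕ} [Fact p.Prime]

/-- **Castella–Grossi–Skinner 2025, Theorem 6.5.3, LAST SENTENCE ("Hence the anticyclotomic
Iwasawa–Greenberg main conjecture in Conjecture 3.2.2 holds") = Conj. 3.2.2, second line, PROVED at a
good non-anomalous Eisenstein prime from the named facts Thm. 6.5.3 (BDP display) and Prop. 2.4.5** (final
TeX l.3246–3256 with l.1187–1194, l.1019–1028). Under `GreenbergSetting ι W N K 𝔭 𝔭̄ κ₁ κ₂`, (Heeg),
`Red W p`, `¬ Anom W p`, (h1) `E(K)[p] = 0`, for `f` the newform of `W` at level `N`, EVERY adapted generator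
pair `(γ₁, γ₂)`, EVERY Katz/Greenberg frame `(LK, G)` at `(γ₁⁻¹, γ₂⁻¹)` and EVERY structure-compatible
`J : ℤ_p → 𝒪_{ℂ_p}`: `𝔛_Gr(E/K_∞⁻) = AcSelmer.XAc (W.baseChange K) p κ₂ 𝔭̄ ∅ γ₂` is `Λ`-torsion and
`(char_Λ 𝔛_Gr)·𝒪_{ℂ_p}⟦T⟧ = (𝓛_p^Gr(f/K)⁻)`, `𝓛_p^Gr(f/K)⁻ = minus G`. Proof: Thm. 6.5.3 gives a BDP frame
`(Ω_K ≠ 0, Ω_p, L)` with `(char)·R₀⟦T⟧ = (L)` along every compatible `j : ℤ_p → R₀`; Prop. 2.4.5 gives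
`(minus G) = (map J₀ L)` along every compatible `J₀ : R₀ → 𝒪_{ℂ_p}`; both maps exist and `J = J₀ ∘ j`.
[cite: CastellaGrossiSkinner2025, Thm. 6.5.3 last sentence (final TeX l.3246–3256) = Conj. 3.2.2 second line (l.1191), via Prop. 2.4.5 (l.1021–1028) and Def. 2.4.3 (l.983–990, l.1019)]
[cite: YanZhu2024MainConjNonCM, Prop. 3.14 and Def. 3.11 (arXiv:2412.20078v4 TeX l.896–903, l.865–871) — the named carrier and Prop. 2.4.5 in its currency] -/
theorem isTorsion_and_charIdeal_map_eq_span_minus_of_thm653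
    (h653 : thm653_exists_isBDPLFunction_isTorsion_charIdeal_map_eq)
    (h314 : prop314_span_minus_eq_span_bdp_anyRoot)
    (ι : PadicAlgCl p ≃+* ℂ) (W : WeierstrassCurve ℚ) [W.IsElliptic] [W.IsGloballyMinimal]
    (K : Type) [Field K] [NumberField K] (v vbar : HeightOneSpectrum (𝓞 K)) (κ₁ κ₂ : ZpExtension K p)
    (γ₁ γ₂ : absoluteGaloisGroup K) [Fact (ZpExtension.IsTopGeneratorPair κ₁ κ₂ γ₁ γ₂)]
    [Fact (κ₂.IsTopGenerator γ₂)]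
    {N : ℕ} [NeZero N] {f : CuspForm (CongruenceSubgroup.Gamma0 N) 2} (hf : IsNewformOf W f)
    [NeZero (NumberField.discr K).natAbs]
    (hset : GreenbergSetting ι W N K v vbar κ₁ κ₂) (hH : SatisfiesHeegnerHypothesis N K)
    (hred : Red W p) (hna : ¬ Anom W p)
    (h1 : ∀ Q : (W.baseChange K).toAffine.Point, p • Q = 0 → Q = 0)
    {Ω δ : ℂ} {Ωp : (unrIntegers p)ˣ} {LK G : PowerSeries (PowerSeries (PadicComplexInt p))}
    (hLK : IsKatzMeasure₂ ι v vbar ∅ κ₁ κ₂ γ₁⁻¹ γ₂⁻¹ 1 Ω δ ((Ωp : unrIntegers p) : ℂ_[p]) LK)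
    (hG : IsGreenbergLFunctionAnyRoot₂ ι v vbar κ₁ κ₂ γ₁⁻¹ γ₂⁻¹ f (NumberField.discr K).natAbs
      (NumberField.classNumber K) LK G)
    (J : ℤ_[p] →+* PadicComplexInt p)
    (hJ : ∀ x : ℤ_[p], ((J x : PadicComplexInt p) : ℂ_[p]) = ((x : ℚ_[p]) : ℂ_[p])) :
    Module.IsTorsion (IwasawaAlgebra p) (AcSelmer.XAc (W.baseChange K) p κ₂ vbar ∅ γ₂) ∧
      (AcSelmer.XAc.charIdeal (W.baseChange K) p κ₂ vbar ∅ γ₂).map (PowerSeries.map J) =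
        Ideal.span {minus G} := by
  have hp : 2 < p := by have := hset.three_le; omega
  -- Thm. 6.5.3: the BDP frame and the equality along every compatible `j : ℤ_p → R₀`
  obtain ⟨ΩK, Ωp', L, hΩK, hBDP, htor, heq⟩ := h653 ι W K v vbar κ₂ γ₂ hf hp hset.goodOrd.1 hred hna
    hset.isImaginaryQuadratic hH hset.split hset.discr_odd hset.discr_ne h1 hset.compat hset.mem_vbar
    hset.vbar_ne hset.anticyclotomic
  -- the structure maps `ℤ_p → R₀ → 𝒪_{ℂ_p}` and `J = J₀ ∘ j`
  obtain ⟨j, hj⟩ := exists_ringHom_padicInt_unrIntegers p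
  obtain ⟨J₀, hJ₀⟩ := exists_ringHom_unrIntegers_padicComplexInt (p := p)
  have hJeq : J = J₀.comp j := ringHom_padicComplexInt_eq_comp hJ hj hJ₀
  -- Prop. 2.4.5 in the Yan–Zhu currency, fed with the BDP frame of Thm. 6.5.3
  have h245 : Ideal.span {minus G} = Ideal.span {PowerSeries.map J₀ L} :=
    h314 ι W K v vbar κ₁ κ₂ γ₁ γ₂ hf hset hH Ω δ Ωp LK G hLK hG ΩK Ωp' L hΩK hBDP J₀ hJ₀
  refine ⟨htor, ?_⟩
  rw [hJeq, PowerSeries.map_comp, ← Ideal.map_map, heq j hj, Ideal.map_span, Set.image_singleton, h245]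

/-- **The same, unconditional in `J`** (a structure-compatible `J : ℤ_p → 𝒪_{ℂ_p}` exists:
`exists_structureMap_padicInt`): `𝔛_Gr(E/K_∞⁻)` is torsion and SOME compatible `J` carries
`(char_Λ 𝔛_Gr)·𝒪_{ℂ_p}⟦T⟧ = (𝓛_p^Gr(f/K)⁻)`.
[cite: CastellaGrossiSkinner2025, Thm. 6.5.3 last sentence (final TeX l.3246–3256) = Conj. 3.2.2 second line (l.1191), via Prop. 2.4.5 (l.1021–1028)] -/
theorem isTorsion_and_exists_structureMap_charIdeal_map_eq_span_minus_of_thm653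
    (h653 : thm653_exists_isBDPLFunction_isTorsion_charIdeal_map_eq)
    (h314 : prop314_span_minus_eq_span_bdp_anyRoot)
    (ι : PadicAlgCl p ≃+* ℂ) (W : WeierstrassCurve ℚ) [W.IsElliptic] [W.IsGloballyMinimal]
    (K : Type) [Field K] [NumberField K] (v vbar : HeightOneSpectrum (𝓞 K)) (κ₁ κ₂ : ZpExtension K p)
    (γ₁ γ₂ : absoluteGaloisGroup K) [Fact (ZpExtension.IsTopGeneratorPair κ₁ κ₂ γ₁ γ₂)]
    [Fact (κ₂.IsTopGenerator γ₂)]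
    {N : ℕ} [NeZero N] {f : CuspForm (CongruenceSubgroup.Gamma0 N) 2} (hf : IsNewformOf W f)
    [NeZero (NumberField.discr K).natAbs]
    (hset : GreenbergSetting ι W N K v vbar κ₁ κ₂) (hH : SatisfiesHeegnerHypothesis N K)
    (hred : Red W p) (hna : ¬ Anom W p)
    (h1 : ∀ Q : (W.baseChange K).toAffine.Point, p • Q = 0 → Q = 0)
    {Ω δ : ℂ} {Ωp : (unrIntegers p)ˣ} {LK G : PowerSeries (PowerSeries (PadicComplexInt p))}
    (hLK : IsKatzMeasure₂ ι v vbar ∅ κ₁ κ₂ γ₁⁻¹ γ₂⁻¹ 1 Ω δ ((Ωp : unrIntegers p) : ℂ_[p]) LK)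
    (hG : IsGreenbergLFunctionAnyRoot₂ ι v vbar κ₁ κ₂ γ₁⁻¹ γ₂⁻¹ f (NumberField.discr K).natAbs
      (NumberField.classNumber K) LK G) :
    Module.IsTorsion (IwasawaAlgebra p) (AcSelmer.XAc (W.baseChange K) p κ₂ vbar ∅ γ₂) ∧
      ∃ J : ℤ_[p] →+* PadicComplexInt p,
        (∀ x : ℤ_[p], ((J x : PadicComplexInt p) : ℂ_[p]) = ((x : ℚ_[p]) : ℂ_[p])) ∧
        (AcSelmer.XAc.charIdeal (W.baseChange K) p κ₂ vbar ∅ γ₂).map (PowerSeries.map J) =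
          Ideal.span {minus G} := by
  obtain ⟨J, hJ⟩ := exists_structureMap_padicInt (p := p)
  obtain ⟨htor, heq⟩ := isTorsion_and_charIdeal_map_eq_span_minus_of_thm653 h653 h314 ι W K v vbar κ₁
    κ₂ γ₁ γ₂ hf hset hH hred hna h1 hLK hG J hJ
  exact ⟨htor, J, hJ, heq⟩

/-- **Corollary — the two one-sided divisibilities of the "Hence" clause, per frame**: along every
structure-compatible `J`, (i) `𝓛_p^Gr(f/K)⁻ ∈ (char_Λ 𝔛_Gr)·𝒪_{ℂ_p}⟦T⟧` and (ii) `𝓛_p^Gr(f/K)⁻` divides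
every element of `(char_Λ 𝔛_Gr)·𝒪_{ℂ_p}⟦T⟧` — the shape in which Iwasawa-theoretic consumers (Euler-system
upper bound / lower bound) read an equality of principal ideals.
[cite: CastellaGrossiSkinner2025, Thm. 6.5.3 last sentence (final TeX l.3246–3256), equality of ideals read as two inclusions] -/
theorem minus_mem_and_dvd_of_thm653
    (h653 : thm653_exists_isBDPLFunction_isTorsion_charIdeal_map_eq)
    (h314 : prop314_span_minus_eq_span_bdp_anyRoot)
    (ι : PadicAlgCl p ≃+* ℂ) (W : WeierstrassCurve ℚ) [W.IsElliptic] [W.IsGloballyMinimal]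
    (K : Type) [Field K] [NumberField K] (v vbar : HeightOneSpectrum (𝓞 K)) (κ₁ κ₂ : ZpExtension K p)
    (γ₁ γ₂ : absoluteGaloisGroup K) [Fact (ZpExtension.IsTopGeneratorPair κ₁ κ₂ γ₁ γ₂)]
    [Fact (κ₂.IsTopGenerator γ₂)]
    {N : ℕ} [NeZero N] {f : CuspForm (CongruenceSubgroup.Gamma0 N) 2} (hf : IsNewformOf W f)
    [NeZero (NumberField.discr K).natAbs]
    (hset : GreenbergSetting ι W N K v vbar κ₁ κ₂) (hH : SatisfiesHeegnerHypothesis N K)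
    (hred : Red W p) (hna : ¬ Anom W p)
    (h1 : ∀ Q : (W.baseChange K).toAffine.Point, p • Q = 0 → Q = 0)
    {Ω δ : ℂ} {Ωp : (unrIntegers p)ˣ} {LK G : PowerSeries (PowerSeries (PadicComplexInt p))}
    (hLK : IsKatzMeasure₂ ι v vbar ∅ κ₁ κ₂ γ₁⁻¹ γ₂⁻¹ 1 Ω δ ((Ωp : unrIntegers p) : ℂ_[p]) LK)
    (hG : IsGreenbergLFunctionAnyRoot₂ ι v vbar κ₁ κ₂ γ₁⁻¹ γ₂⁻¹ f (NumberField.discr K).natAbs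
      (NumberField.classNumber K) LK G)
    (J : ℤ_[p] →+* PadicComplexInt p)
    (hJ : ∀ x : ℤ_[p], ((J x : PadicComplexInt p) : ℂ_[p]) = ((x : ℚ_[p]) : ℂ_[p])) :
    minus G ∈ (AcSelmer.XAc.charIdeal (W.baseChange K) p κ₂ vbar ∅ γ₂).map (PowerSeries.map J) ∧
      ∀ x ∈ (AcSelmer.XAc.charIdeal (W.baseChange K) p κ₂ vbar ∅ γ₂).map (PowerSeries.map J),
        minus G ∣ x := by
  obtain ⟨-, heq⟩ := isTorsion_and_charIdeal_map_eq_span_minus_of_thm653 h653 h314 ι W K v vbar κ₁ κ₂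
    γ₁ γ₂ hf hset hH hred hna h1 hLK hG J hJ
  rw [heq]
  exact ⟨Ideal.mem_span_singleton_self _, fun x hx ↦ Ideal.mem_span_singleton.mp hx⟩

end Literature.NumberTheory.EllipticCurves.CastellaGrossiSkinner2025

end
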